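import Summits.CriticalPhenomena.CardyFormulaZ2.Theses.CardyMeckeFlip
import Literature.Probability.Percolation.FlipFairKernel
import Literature.Probability.Percolation.Z2PivotalMeasure
import Literature.Probability.Percolation.ZdFourArmQuasiMult
import Literature.Probability.Distributions.AntitoneKernelVersionAE
import Summits.CriticalPhenomena.CardyFormulaZ2.Theorems.CardyMeckeFlipFlipErgodicityZ2StubFlipExtremalOfTrivialDensity
import Summits.CriticalPhenomena.CardyFormulaZ2.Theorems.CardyMeckeFlipFlipErgodicityZ2StubLatticeCampbellKernel
import Summits.CriticalPhenomena.CardyFormulaZ2.Theorems.CardyMeckeFlipFlipErgodicityZ2StubLatticePivotalAntitone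
import Summits.CriticalPhenomena.CardyFormulaZ2.Theorems.CardyMeckeFlipFlipErgodicityZ2StubPatternCampbellLimit
import Summits.CriticalPhenomena.CardyFormulaZ2.Theorems.CardyMeckeFlipFlipErgodicityZ2StubLatticeSecondMomentOfQuasiMult
import Summits.CriticalPhenomena.CardyFormulaZ2.Theorems.CardyMeckeFlipFlipErgodicityZ2StubKernelExistsZ2OfLatticeBallPosOfLimit
import Summits.CriticalPhenomena.CardyFormulaZ2.Theorems.CardyMeckeFlipFlipErgodicityZ2StubKernelExistsZ2OfLatticeAeAntitoneOfLimit
import Summits.CriticalPhenomena.CardyFormulaZ2.Theorems.CardyMeckeFlipFlipErgodicityZ2StubFlipPassesToLimitOfNodeC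
import Summits.CriticalPhenomena.CardyFormulaZ2.Theorems.CardyMeckeFlipZ2LimitsSymmetricIsometryOfRotation

/-!
# Birth skeleton (BC3) for crux `FlipErgodicityZ2` — route `CardyMeckeFlip`, item stmt-CriticalPhenomena-14825

Crux (K3 of the route, rank 3): every subsequential quad-crossing scaling limit `μ ∈ Λ =
subseqQuadLimits univ` of bond-`ℤ²` percolation at `p = ½` carries an admissible,
isometry-equivariant kernel family `M` (clause (ADM)) that is flip-fair for `μ` at every cutoff
(clause (F)) and for which `μ` is midpoint-extremal among the flip-fair probability laws (clause
(EXT), "flip-ergodicity").  The crux inlines (ADM)/(F)/(EXT) over a characterised parameter `Piv`;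
the named notions are `Literature/Probability/Percolation/FlipFairKernel.lean`
(`QuadConfig.IsPivotalAt`, `IsAdmissibleKernel`, `IsIsometryEquivariant`, `IsFlipFairKernel`,
`IsFlipExtremal`, each `Iff.rfl` against the inlined text) and
`Literature/Probability/Percolation/Z2PivotalMeasure.lean` (`z2PivotalMeasure ε δ ω`, GPS's
isometry-averaged normalised `ε`-important counting measure of bond-`ℤ²`; `IsZ2PivotalKernelLimit μ M`:
"`M` is its joint subsequential limit with the configuration") — the skeleton is stated over the
NAMED notions and pinned to THE canonical (GPS) kernel.

The cut follows the route's own two-layer plan (`FlipErgodicityZ2 ⇐ FlipIdentityZ2 →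
PivotalKernelErgodic`, `FlipIdentityZ2 ⇐ KernelExistsZ2 → FlipPassesToLimit`).

**Reshape 3 (lead c3, 2026-08-17, after wave 1).**  Every piece of the two `ℤ²`-construction
stubs that is provable glue has now LANDED, and what remains is registered as single-topic stubs,
each either a published bond-`ℤ²` arm estimate (Literature debt), a precisely typed unprinted
step of the Garban–Pete–Schramm programme for `ℤ²`, a clause of the sibling crux
`Z2LimitsSymmetric`, or the open problem:

* `stub_zdFourArmFacts` — the three PUBLISHED bond-`ℤ²` four-arm estimates (Nolin 2008 Prop. 17 /
  §8.1 edge quasi-multiplicativity; Duminil-Copin–Manolescu–Tassion 2021 Prop. 6.3 and Prop. 6.8 at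
  `q = 1`), named facts of `Literature/Probability/Percolation/ZdFourArmQuasiMult.lean` (p158434);
  from them `stub_latticeSecondMoment` (B2) is CLOSED by the landed conditional proof
  `latticeSecondMoment_of_quasiMult` (p158438 + 7 helper files).
* `stub_jointKernelLimit` (N1) — GPS 2013 Thm 4.3/§4.7 for bond-`ℤ²` along the static
  subsequence: a joint MULTI-CUTOFF limit `(ω_δ, (μ^(εⱼ)_δ)ⱼ) ⇒ (S, (M εⱼ S)ⱼ)` with a measurable,
  locally integrable kernel (asserted GPS13 §1 p. 10, never written; XXL).
* `stub_pivotalSupport` (N6) — clause (ADM)(4) for such a limit: limits of `ε`-important edges are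
  `IsPivotalAt`-pivotal (unprinted identification; census risk R2).
* `stub_rotationInvariantLimits` — rotation invariance of every `μ ∈ Λ` (DKKMO 2020), VERBATIM the
  open stub of crux `Z2LimitsSymmetric` (stmt-CriticalPhenomena-14827); full isometry invariance
  then by the landed `stub_isometryOfRotation` (`CardyMeckeFlipZ2LimitsSymmetricIsometryOfRotation.lean`).
* `stub_equivariantVersion` (N7) — for an isometry-invariant `μ`, an admissible joint-limit kernel
  has an everywhere-equivariant admissible version (GPS13 §4.7 intrinsic description: the
  grid-averaged kernel is `∫ c(θ) Φ_θ dθ`, equivariant iff the direction-dependent arm-ratio limits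
  are constant, which law-level rotation invariance supplies; plus Zimmer-type strictification of an
  a.e.-equivariant kernel; census risk R3).
* glue of stub 1, ALL LANDED: lattice antitonicity `stub_latticePivotalAntitone` (p149777) passes to
  joint limits `ae_kernel_le_of_jointLimit'` (p161491, via p159645 `ae_le_of_tendsto_pair`, p161069
  determining class); everywhere-antitone measurable versions `exists_antitone_version_of_ae_antitone`
  (p162018, p159809); clause (ADM)(5) for every pivotal-kernel limit `exists_lintegral_kernel_ball_pos`
  (p160762, from the lattice first-moment lower bound p159450).
* `stub_nodeC` — the TOGGLED (pattern-split) Campbell functionals pass to the limit identified by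
  `IsPivotalAt` (GPS13 Thm 1.1 for `μ^Q` + GPS18 §6–7 on `𝕋`; unprinted for `ℤ²`; absorbs R1/R2);
  from it `stub_flipPassesToLimit_of_glue` (2b) is CLOSED by the landed glue
  `flipPassesToLimit_of_nodeC` (p163085), on top of the landed lattice Campbell–Mecke identity
  `stub_latticeCampbellKernel` (p145533) and pattern Campbell limit `stub_patternCampbellLimit`
  (p150116).
* `stub_pivotalKernelErgodic` (the open core; `𝕋`-analogue GHSS arXiv:1905.06940 Thm 1.4(i) +
  Rem. 1.5; GPS 2018 §12.1 Remark), density form; `stub_flipExtremal_of_trivialDensity` (CLOSED,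
  p143383) converts it to (EXT).

**Landed sub-nodes of the open stubs (lead c3, waves 2–3; all accepted, `--supports` this item).**
N1: tightness ⇒ Prokhorov subsequential joint LAW for countable cutoff/test families
(`Literature/Probability/Distributions/JointLawSubseqLimit.lean` p165827,
`Literature/Probability/Percolation/Z2PivotalJointSubseqLimit.lean` p166319), a countable
dominating-dense test family in `C_c(ℂ)` (`…/Distributions/CountableTestFamily.lean` p169060) and the
Riesz–Markov KERNEL from a measurable family of a.s.-positive a.s.-linear functionals
(`…/Distributions/RieszMarkovKernel(Measurable).lean` p169510, p169563) — what remains of N1 is the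
unprinted core N1b (the joint limit law is supported on a graph: GPS13 Prop. 4.1/4.5, Lemma 4.6 for
`ℤ²`) plus the all-real-cutoffs glue N1e (sandwich by the landed lattice antitonicity).  N7: exact
covariance of the averaged lattice kernel under lattice translations and a.e. TRANSLATION-equivariance
of every joint-limit kernel under a translation-invariant `μ` (`…StubEquivariantVersionLatticeCovariance`
p168033, `…Perturbation` p168054, `…TranslationEquivariant` p168488, `…/Distributions/AEEqOfJointLaw.lean`
p167989) — what remains is a.e. ROTATION-equivariance (arm-ratio level, R3, unprinted), the `D₄` lattice
covariance (provable) and Zimmer strictification.  Node (C)/N6: the LATTICE identification of the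
open-pivotal clause of `IsPivotalAt` with lattice pivotality at an edge midpoint, both directions
(`Literature/Probability/Percolation/Z2LatticePivotalOpenClause.lean` p164937,
`…Z2LatticePivotalOpenClauseConverse.lean` p170937: `isPivotalAt_z2QuadConfig_iff_not_mem_sdiff`), via the
sub-quad thickening lemma `Quad.exists_subquad_isCrossing_subset` (`QuadSubquadThickening*.lean` p170869,
p170279, p170575, p170625; drawn arcs `Z2DrawnArcs.lean` p170579) — what remains is the identification IN
THE LIMIT (closed-pivotal clause and convergence of the toggled functionals; unprinted).  Stub 3: the
converse of stub 4, `IsFlipExtremal.withDensity_eq` (`…/Percolation/FlipExtremalDensity.lean` p163704), so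
the density form is exactly as strong as (EXT).

`FlipErgodicityZ2_of : FlipErgodicityZ2` is the kernel-checked composition (its term has no `sorry`;
`sorryAx` enters only through the named stubs).  Sorries: exactly the seven open `stub_*`
(`stub_zdFourArmFacts`, `stub_jointKernelLimit`, `stub_pivotalSupport`,
`stub_rotationInvariantLimits`, `stub_equivariantVersion`, `stub_nodeC`, `stub_pivotalKernelErgodic`).
-/

noncomputable section

open MeasureTheory Set Filter Topology Metric
open Literature.Probability.Percolation Literature.Probability.Percolation.QuadCrossing
open Literature.Probability.LatticeModels Literature.Probability.Distributions

namespace Summit.CriticalPhenomena.CardyFormulaZ2.Cruxes.FlipErgodicityZ2.Birth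

/-- stub 1a — LATTICE ANTITONICITY IN THE CUTOFF (reshape 2; CLOSED by p149777): for `0 < δ ≤ ε' ≤ ε`
the isometry-averaged weight of every edge of `δℤ²` at cutoff `ε` is at most its weight at cutoff
`ε'` (couple the shifts of the moved grids at the two scales so that the edge midpoint keeps its
relative position `t ∈ [0,1)²` in its grid square: the `3ε'`-block is `m + ε'([-1,2]² - t)` in grid
frame coordinates, inside the `3ε`-block `m + ε([-1,2]² - t)` and containing both endpoints of the
edge since `δ/2 ≤ ε'`; four arms to the boundary of the larger block restrict to four arms to the
boundary of the smaller one (first-exit decomposition of open lattice paths — whence the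
hypothesis that `ω` opens only lattice edges, a `P_½`-almost sure event); the coupling preserves
`gridParamLaw`). -/
theorem stub_latticePivotalAntitone :
    ∀ (ε ε' δ : ℝ), 0 < δ → δ ≤ ε' → ε' ≤ ε →
      ∀ (ω : BondConfig (Site 2)), ω ⊆ (zdGraph 2).edgeSet → ∀ (x : Site 2) (i : Fin 2),
        pivotalWeight ε δ ω x i ≤ pivotalWeight ε' δ ω x i :=
  -- CLOSED (reshape 2, wave 1 of lead c2, p149777): landed as
  -- `Theorems/CardyMeckeFlipFlipErgodicityZ2StubLatticePivotalAntitone.lean`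
  Summit.CriticalPhenomena.CardyFormulaZ2.Theorems.CardyMeckeFlip.stub_latticePivotalAntitone

/-- stub 1b-F — THE THREE PUBLISHED BOND-`ℤ²` FOUR-ARM ESTIMATES (reshape 3; Literature debt,
named facts of `ZdFourArmQuasiMult.lean`, p158434): edge four-arm quasi-multiplicativity at
`p = 1/2` (Nolin 2008 Prop. 17 with §8.1; Kesten 1987), annulus four-arm quasi-multiplicativity and
the four-arm lower bound `c (r/R)^{2-c} ≤ α₄(r,R)` (Duminil-Copin–Manolescu–Tassion 2021 Prop. 6.3,
Prop. 6.8 at `q = 1`).  Discharging them (`…_holds`) closes B2 below. -/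
theorem stub_zdFourArmFacts :
    Nolin2008_zdEdgeFourArmQuasiMult ∧ DuminilCopinManolescuTassion2021_zdFourArm_quasiMult ∧
      DuminilCopinManolescuTassion2021_zdFourArm_lowerBound := by
  sorry

/-- stub 1b — UNIFORM SECOND MOMENTS OF THE LATTICE KERNELS (GPS 2013 §4.3–4.6 transplanted to
bond-`ℤ²`): for every cutoff `ε > 0` and `φ ∈ C_c(ℂ)`, `sup_{0 < δ ≤ δ₀} E[⟨μ^ε_δ, |φ|⟩²] < ∞`.
CLOSED modulo `stub_zdFourArmFacts` by the landed conditional proof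
`latticeSecondMoment_of_quasiMult` (wave 1 of lead c3, p158438; helpers p155280, p155318,
p155707, p155863, p156166, p156825, p157535). -/
theorem stub_latticeSecondMoment :
    ∀ ε : ℝ, 0 < ε → ∀ φ : ℂ → ℝ, Continuous φ → HasCompactSupport φ →
      ∃ C δ₀ : ℝ, 0 < δ₀ ∧ ∀ δ : ℝ, 0 < δ → δ ≤ δ₀ →
        ∫ ω, (∫ x, |φ x| ∂(z2PivotalMeasure ε δ ω)) ^ 2 ∂(bondPercolation (zdGraph 2) half) ≤ C :=
  Summit.CriticalPhenomena.CardyFormulaZ2.Theorems.CardyMeckeFlip.latticeSecondMoment_of_quasiMult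
    stub_zdFourArmFacts.1 stub_zdFourArmFacts.2.1 stub_zdFourArmFacts.2.2

/-- stub 1-N1 — THE JOINT MULTI-CUTOFF PIVOTAL-KERNEL LIMIT EXISTS, WITH A MEASURABLE KERNEL
(GPS 2013 arXiv:1008.1378 Thm 4.3 + §4.7 for bond-`ℤ²` along the static subsequence; asserted §1
p. 10, never written).  From the uniform second moments: for every `μ ∈ Λ` there are a mesh
sequence `δ_k → 0⁺` realising `μ` and kernels `M₀ ε`, measurable with locally integrable first
moments, such that `(ω_δ, (⟨μ^(εⱼ)_δ, φⱼ⟩)ⱼ) → (S, (⟨M₀ εⱼ S, φⱼ⟩)ⱼ)` in law for all finite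
families of cutoffs and test functions (the `εⱼ ≡ ε` case is the convergence clause of
`IsZ2PivotalKernelLimit`).  Sub-nodes: tightness (provable from B2), the limit functional is a.s. a
FUNCTION of the configuration (GPS13 Prop. 4.1/4.5, Lemma 4.6: ratio-limit + coupling; UNPRINTED
for `ℤ²`), Riesz–Markov. -/
theorem stub_jointKernelLimit :
    (∀ ε : ℝ, 0 < ε → ∀ φ : ℂ → ℝ, Continuous φ → HasCompactSupport φ →
      ∃ C δ₀ : ℝ, 0 < δ₀ ∧ ∀ δ : ℝ, 0 < δ → δ ≤ δ₀ →
        ∫ ω, (∫ x, |φ x| ∂(z2PivotalMeasure ε δ ω)) ^ 2 ∂(bondPercolation (zdGraph 2) half) ≤ C) →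
    ∀ μ : FiniteMeasure (QuadConfig (Set.univ : Set ℂ)), μ ∈ subseqQuadLimits (Set.univ : Set ℂ) →
      ∃ (δs : ℕ → ℝ) (M₀ : ℝ → QuadConfig (Set.univ : Set ℂ) → Measure ℂ),
        (∀ k, 0 < δs k) ∧ Tendsto δs atTop (𝓝 0) ∧
          Tendsto (fun k => z2QuadLaw (Set.univ : Set ℂ) (δs k)) atTop (𝓝 μ) ∧
            (∀ ε : ℝ, Measurable (M₀ ε)) ∧
              (∀ ε : ℝ, 0 < ε → ∀ r : ℝ,
                ∫⁻ S, M₀ ε S (closedBall 0 r) ∂(μ : Measure (QuadConfig (Set.univ : Set ℂ))) < ⊤) ∧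
        (∀ (m : ℕ) (εs : Fin m → ℝ) (φ : Fin m → ℂ → ℝ), (∀ j, 0 < εs j) → (∀ j, Continuous (φ j)) →
          (∀ j, HasCompactSupport (φ j)) →
            ∀ F : BoundedContinuousFunction (QuadConfig (Set.univ : Set ℂ) × (Fin m → ℝ)) ℝ,
              Tendsto
                (fun k => ∫ ω, F (z2QuadConfig (Set.univ : Set ℂ) (δs k) ω,
                    fun j => ∫ x, φ j x ∂(z2PivotalMeasure (εs j) (δs k) ω))
                  ∂(bondPercolation (zdGraph 2) half))
                atTop
                (𝓝 (∫ S, F (S, fun j => ∫ x, φ j x ∂(M₀ (εs j) S))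
                  ∂(μ : Measure (QuadConfig (Set.univ : Set ℂ)))))) := by
  sorry

/-- stub 1-N6 — THE SUPPORT CLAUSE (ADM)(4) OF A JOINT-LIMIT KERNEL (unprinted identification:
limits of `ε`-important edges of `δℤ²` are `IsPivotalAt`-pivotal for some quad of the limit
configuration; GPS 2013 §2.3/§4.1 identify importance with continuum four-arm events on `𝕋`;
census risk R2 — measurability of the section).  For a mesh sequence realising `μ` and a
measurable, locally integrable kernel family that is the joint multi-cutoff limit along it,
`M ε S` charges no non-pivotal point, `μ`-a.s. -/
theorem stub_pivotalSupport :
    ∀ (μ : FiniteMeasure (QuadConfig (Set.univ : Set ℂ)))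
      (M : ℝ → QuadConfig (Set.univ : Set ℂ) → Measure ℂ) (δs : ℕ → ℝ),
      (∀ k, 0 < δs k) → Tendsto δs atTop (𝓝 0) →
        Tendsto (fun k => z2QuadLaw (Set.univ : Set ℂ) (δs k)) atTop (𝓝 μ) →
        (∀ (m : ℕ) (εs : Fin m → ℝ) (φ : Fin m → ℂ → ℝ), (∀ j, 0 < εs j) → (∀ j, Continuous (φ j)) →
          (∀ j, HasCompactSupport (φ j)) →
            ∀ F : BoundedContinuousFunction (QuadConfig (Set.univ : Set ℂ) × (Fin m → ℝ)) ℝ,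
              Tendsto
                (fun k => ∫ ω, F (z2QuadConfig (Set.univ : Set ℂ) (δs k) ω,
                    fun j => ∫ x, φ j x ∂(z2PivotalMeasure (εs j) (δs k) ω))
                  ∂(bondPercolation (zdGraph 2) half))
                atTop
                (𝓝 (∫ S, F (S, fun j => ∫ x, φ j x ∂(M (εs j) S))
                  ∂(μ : Measure (QuadConfig (Set.univ : Set ℂ)))))) →
        (∀ ε : ℝ, Measurable (M ε)) →
        (∀ ε : ℝ, 0 < ε → ∀ r : ℝ,
          ∫⁻ S, M ε S (closedBall 0 r) ∂(μ : Measure (QuadConfig (Set.univ : Set ℂ))) < ⊤) →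
          ∀ ε : ℝ, 0 < ε → ∀ᵐ S ∂(μ : Measure (QuadConfig (Set.univ : Set ℂ))),
            M ε S {x | ¬ ∃ Q : Quad (Set.univ : Set ℂ), S.IsPivotalAt x Q} = 0 := by
  sorry

/-- stub 1-R — ROTATION INVARIANCE OF `ℤ²` SUBLIMITS (Duminil-Copin–Kozlowski–Krachun–Manolescu–
Oulamara 2020, arXiv:2012.11672, Thm 1.1/1.4, law level on `ℋ_ℂ`): VERBATIM the open stub
`stub_rotationInvariantLimits` of the sibling crux `Z2LimitsSymmetric` (stmt-CriticalPhenomena-14827,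
line `registered`); isometry invariance of `μ` then follows from the landed
`stub_isometryOfRotation`.  Needed here because (ADM)(6) for the CANONICAL kernel is as strong as
rotation invariance at arm-ratio level (census risk R3; GPS 2013 Remark 6.2 / §4.7). -/
theorem stub_rotationInvariantLimits :
    ∀ μ ∈ subseqQuadLimits (Set.univ : Set ℂ), ∀ α : ℝ,
      isometryLaw (rotation (Circle.exp α)).toIsometryEquiv μ = μ := by
  sorry

/-- stub 1-N7 — AN EQUIVARIANT ADMISSIBLE VERSION (clause (ADM)(6); GPS 2013 §4.7: the
grid-averaged `ℤ²` kernel is `∫ c(θ) Φ_θ dθ` with direction-dependent two-scale four-arm ratio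
limits `c(θ)`, constant once `μ` is rotation-invariant at law level; then an a.e.-equivariant
measurable kernel under `Isom(ℂ)` acting on `(ℋ_ℂ, μ)` with `μ` invariant has an everywhere-
equivariant measurable version — Zimmer 1984 App. B; the intrinsic description of the limit kernel
for `ℤ²` is UNPRINTED, census risk R3).  For an isometry-invariant `μ`, a mesh sequence realising it
and an admissible joint multi-cutoff limit kernel `M`, there is `M'`, a.e. equal to `M` at every
cutoff, admissible, still the joint limit, and isometry-equivariant. -/
theorem stub_equivariantVersion :
    ∀ (μ : FiniteMeasure (QuadConfig (Set.univ : Set ℂ)))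
      (M : ℝ → QuadConfig (Set.univ : Set ℂ) → Measure ℂ) (δs : ℕ → ℝ),
      (∀ g : ℂ ≃ᵢ ℂ, Measure.map (QuadConfig.isometry g) (μ : Measure (QuadConfig (Set.univ : Set ℂ))) =
        (μ : Measure (QuadConfig (Set.univ : Set ℂ)))) →
      (∀ k, 0 < δs k) → Tendsto δs atTop (𝓝 0) →
        Tendsto (fun k => z2QuadLaw (Set.univ : Set ℂ) (δs k)) atTop (𝓝 μ) →
        (∀ (m : ℕ) (εs : Fin m → ℝ) (φ : Fin m → ℂ → ℝ), (∀ j, 0 < εs j) → (∀ j, Continuous (φ j)) →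
          (∀ j, HasCompactSupport (φ j)) →
            ∀ F : BoundedContinuousFunction (QuadConfig (Set.univ : Set ℂ) × (Fin m → ℝ)) ℝ,
              Tendsto
                (fun k => ∫ ω, F (z2QuadConfig (Set.univ : Set ℂ) (δs k) ω,
                    fun j => ∫ x, φ j x ∂(z2PivotalMeasure (εs j) (δs k) ω))
                  ∂(bondPercolation (zdGraph 2) half))
                atTop
                (𝓝 (∫ S, F (S, fun j => ∫ x, φ j x ∂(M (εs j) S))
                  ∂(μ : Measure (QuadConfig (Set.univ : Set ℂ)))))) →
        IsAdmissibleKernel (μ : Measure (QuadConfig (Set.univ : Set ℂ))) M →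
          ∃ M' : ℝ → QuadConfig (Set.univ : Set ℂ) → Measure ℂ,
            (∀ ε : ℝ, 0 < ε → ∀ᵐ S ∂(μ : Measure (QuadConfig (Set.univ : Set ℂ))), M' ε S = M ε S) ∧
            IsAdmissibleKernel (μ : Measure (QuadConfig (Set.univ : Set ℂ))) M' ∧
            (∀ (m : ℕ) (εs : Fin m → ℝ) (φ : Fin m → ℂ → ℝ), (∀ j, 0 < εs j) → (∀ j, Continuous (φ j)) →
          (∀ j, HasCompactSupport (φ j)) →
            ∀ F : BoundedContinuousFunction (QuadConfig (Set.univ : Set ℂ) × (Fin m → ℝ)) ℝ,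
              Tendsto
                (fun k => ∫ ω, F (z2QuadConfig (Set.univ : Set ℂ) (δs k) ω,
                    fun j => ∫ x, φ j x ∂(z2PivotalMeasure (εs j) (δs k) ω))
                  ∂(bondPercolation (zdGraph 2) half))
                atTop
                (𝓝 (∫ S, F (S, fun j => ∫ x, φ j x ∂(M' (εs j) S))
                  ∂(μ : Measure (QuadConfig (Set.univ : Set ℂ)))))) ∧
            IsIsometryEquivariant M' := by
  sorry

/-- glue 1-N2/N3 (LANDED pieces assembled; no `sorry`): from a joint multi-cutoff limit with a
measurable, locally integrable kernel and the lattice antitonicity, an everywhere-antitone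
measurable VERSION that is still the joint limit, agrees a.e. with the original at every cutoff,
and is locally integrable (`ae_kernel_le_of_jointLimit'` p161491 +
`exists_antitone_version_of_ae_antitone` p162018). -/
theorem antitoneVersion_of_jointLimit
    (hanti : (∀ (ε ε' δ : ℝ), 0 < δ → δ ≤ ε' → ε' ≤ ε →
      ∀ (ω : BondConfig (Site 2)), ω ⊆ (zdGraph 2).edgeSet → ∀ (x : Site 2) (i : Fin 2),
        pivotalWeight ε δ ω x i ≤ pivotalWeight ε' δ ω x i))
    (μ : FiniteMeasure (QuadConfig (Set.univ : Set ℂ)))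
    (M₀ : ℝ → QuadConfig (Set.univ : Set ℂ) → Measure ℂ) (δs : ℕ → ℝ) (hpos : ∀ k, 0 < δs k)
    (h0 : Tendsto δs atTop (𝓝 0)) (hM₀ : ∀ ε, Measurable (M₀ ε))
    (hfin : ∀ ε : ℝ, 0 < ε → ∀ r : ℝ,
      ∫⁻ S, M₀ ε S (closedBall 0 r) ∂(μ : Measure (QuadConfig (Set.univ : Set ℂ))) < ⊤)
    (hjoint : (∀ (m : ℕ) (εs : Fin m → ℝ) (φ : Fin m → ℂ → ℝ), (∀ j, 0 < εs j) → (∀ j, Continuous (φ j)) →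
          (∀ j, HasCompactSupport (φ j)) →
            ∀ F : BoundedContinuousFunction (QuadConfig (Set.univ : Set ℂ) × (Fin m → ℝ)) ℝ,
              Tendsto
                (fun k => ∫ ω, F (z2QuadConfig (Set.univ : Set ℂ) (δs k) ω,
                    fun j => ∫ x, φ j x ∂(z2PivotalMeasure (εs j) (δs k) ω))
                  ∂(bondPercolation (zdGraph 2) half))
                atTop
                (𝓝 (∫ S, F (S, fun j => ∫ x, φ j x ∂(M₀ (εs j) S))
                  ∂(μ : Measure (QuadConfig (Set.univ : Set ℂ))))))) :
    ∃ M : ℝ → QuadConfig (Set.univ : Set ℂ) → Measure ℂ,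
      (∀ ε, Measurable (M ε)) ∧
        (∀ ε ε' : ℝ, 0 < ε' → ε' ≤ ε → ∀ S, M ε S ≤ M ε' S) ∧
          (∀ ε : ℝ, 0 < ε → ∀ᵐ S ∂(μ : Measure (QuadConfig (Set.univ : Set ℂ))), M ε S = M₀ ε S) ∧
          (∀ ε : ℝ, 0 < ε → ∀ r : ℝ,
            ∫⁻ S, M ε S (closedBall 0 r) ∂(μ : Measure (QuadConfig (Set.univ : Set ℂ))) < ⊤) ∧
            (∀ (m : ℕ) (εs : Fin m → ℝ) (φ : Fin m → ℂ → ℝ), (∀ j, 0 < εs j) → (∀ j, Continuous (φ j)) →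
          (∀ j, HasCompactSupport (φ j)) →
            ∀ F : BoundedContinuousFunction (QuadConfig (Set.univ : Set ℂ) × (Fin m → ℝ)) ℝ,
              Tendsto
                (fun k => ∫ ω, F (z2QuadConfig (Set.univ : Set ℂ) (δs k) ω,
                    fun j => ∫ x, φ j x ∂(z2PivotalMeasure (εs j) (δs k) ω))
                  ∂(bondPercolation (zdGraph 2) half))
                atTop
                (𝓝 (∫ S, F (S, fun j => ∫ x, φ j x ∂(M (εs j) S))
                  ∂(μ : Measure (QuadConfig (Set.univ : Set ℂ)))))) := by
  -- N2: a.e. antitone, from the lattice antitonicity along the two-cutoff marginals of the joint limit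
  have hae : ∀ ε ε' : ℝ, 0 < ε' → ε' ≤ ε →
      ∀ᵐ S ∂(μ : Measure (QuadConfig (Set.univ : Set ℂ))), M₀ ε S ≤ M₀ ε' S := by
    intro ε ε' hε' hle
    have hε : 0 < ε := hε'.trans_le hle
    refine Summit.CriticalPhenomena.CardyFormulaZ2.Theorems.CardyMeckeFlip.ae_kernel_le_of_jointLimit'
      hanti μ M₀ δs hpos h0 hε' hle (hM₀ ε) (hM₀ ε') (hfin ε hε) (hfin ε' hε') fun φ hφ hφc F => ?_
    have h := hjoint 2 ![ε, ε'] ![φ, φ] (fun j => by fin_cases j <;> simpa)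
      (fun j => by fin_cases j <;> simpa) (fun j => by fin_cases j <;> simpa) F
    have e1 : ∀ (k : ℕ) (ω : BondConfig (Site 2)),
        (fun j : Fin 2 => ∫ x, (![φ, φ] : Fin 2 → ℂ → ℝ) j x
          ∂(z2PivotalMeasure ((![ε, ε'] : Fin 2 → ℝ) j) (δs k) ω)) =
        ![∫ x, φ x ∂(z2PivotalMeasure ε (δs k) ω), ∫ x, φ x ∂(z2PivotalMeasure ε' (δs k) ω)] := by
      intro k ω; funext j; fin_cases j <;> rfl
    have e2 : ∀ S : QuadConfig (Set.univ : Set ℂ),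
        (fun j : Fin 2 => ∫ x, (![φ, φ] : Fin 2 → ℂ → ℝ) j x ∂(M₀ ((![ε, ε'] : Fin 2 → ℝ) j) S)) =
        ![∫ x, φ x ∂(M₀ ε S), ∫ x, φ x ∂(M₀ ε' S)] := by
      intro S; funext j; fin_cases j <;> rfl
    simp only [e1, e2] at h
    exact h
  -- N3: the everywhere-antitone measurable version
  have hfinK : ∀ ε : ℝ, 0 < ε → ∀ K : Set ℂ, IsCompact K →
      ∫⁻ S, M₀ ε S K ∂(μ : Measure (QuadConfig (Set.univ : Set ℂ))) < ⊤ := by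
    intro ε hε K hK
    obtain ⟨r, hr⟩ := hK.isBounded.subset_closedBall (0 : ℂ)
    exact lt_of_le_of_lt (lintegral_mono fun S => measure_mono hr) (hfin ε hε r)
  obtain ⟨M, hM, hMono, hMae⟩ := exists_antitone_version_of_ae_antitone
    (μ : Measure (QuadConfig (Set.univ : Set ℂ))) M₀ (fun ε _ => hM₀ ε) hfinK hae
  refine ⟨M, hM, fun ε ε' _ hle S => hMono ε ε' hle S, hMae, ?_, ?_⟩
  · intro ε hε r
    rw [lintegral_congr_ae ((hMae ε hε).mono fun S hS => by rw [hS])]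
    exact hfin ε hε r
  · intro m εs φ hεs hφ hφc F
    have hall : ∀ᵐ S ∂(μ : Measure (QuadConfig (Set.univ : Set ℂ))), ∀ j : Fin m,
        M (εs j) S = M₀ (εs j) S := ae_all_iff.2 fun j => hMae (εs j) (hεs j)
    have heq : ∫ S, F (S, fun j => ∫ x, φ j x ∂(M (εs j) S))
          ∂(μ : Measure (QuadConfig (Set.univ : Set ℂ))) =
        ∫ S, F (S, fun j => ∫ x, φ j x ∂(M₀ (εs j) S))
          ∂(μ : Measure (QuadConfig (Set.univ : Set ℂ))) :=
      integral_congr_ae (hall.mono fun S hS => by simp only [hS])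
    rw [heq]
    exact hjoint m εs φ hεs hφ hφc F

/-- glue 1-N4 (trivial projection): a joint multi-cutoff limit along a mesh sequence realising `μ`
is a pivotal-kernel limit in the sense of `IsZ2PivotalKernelLimit` (take `εs ≡ ε`). -/
theorem isZ2PivotalKernelLimit_of_jointLimit (μ : FiniteMeasure (QuadConfig (Set.univ : Set ℂ)))
    (M : ℝ → QuadConfig (Set.univ : Set ℂ) → Measure ℂ) (δs : ℕ → ℝ) (hpos : ∀ k, 0 < δs k)
    (h0 : Tendsto δs atTop (𝓝 0))
    (hlaw : Tendsto (fun k => z2QuadLaw (Set.univ : Set ℂ) (δs k)) atTop (𝓝 μ))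
    (hjoint : (∀ (m : ℕ) (εs : Fin m → ℝ) (φ : Fin m → ℂ → ℝ), (∀ j, 0 < εs j) → (∀ j, Continuous (φ j)) →
          (∀ j, HasCompactSupport (φ j)) →
            ∀ F : BoundedContinuousFunction (QuadConfig (Set.univ : Set ℂ) × (Fin m → ℝ)) ℝ,
              Tendsto
                (fun k => ∫ ω, F (z2QuadConfig (Set.univ : Set ℂ) (δs k) ω,
                    fun j => ∫ x, φ j x ∂(z2PivotalMeasure (εs j) (δs k) ω))
                  ∂(bondPercolation (zdGraph 2) half))
                atTop
                (𝓝 (∫ S, F (S, fun j => ∫ x, φ j x ∂(M (εs j) S))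
                  ∂(μ : Measure (QuadConfig (Set.univ : Set ℂ))))))) :
    IsZ2PivotalKernelLimit μ M :=
  ⟨δs, hpos, h0, hlaw, fun ε hε m φ hφ hφc F => hjoint m (fun _ => ε) φ (fun _ => hε) hφ hφc F⟩

/-- stub 1 — KERNEL EXISTS ON `ℤ²` from the lattice nodes (GPS 2013 Thm 1.1/§4, §1 p. 10; the
construction half of K1 `FlipIdentityZ2`, pinned to the canonical kernel): given lattice
antitonicity (stub 1a) and uniform second moments (stub 1b), every subsequential quad-crossing
limit of bond-`ℤ²` carries a Garban–Pete–Schramm pivotal-kernel limit with an admissible,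
isometry-equivariant version.  CLOSED modulo `stub_jointKernelLimit` (N1), `stub_pivotalSupport`
(N6), `stub_rotationInvariantLimits` (R) and `stub_equivariantVersion` (N7) by the landed glue
(reshape 3). -/
theorem stub_kernelExistsZ2_of_lattice :
    (∀ (ε ε' δ : ℝ), 0 < δ → δ ≤ ε' → ε' ≤ ε →
      ∀ (ω : BondConfig (Site 2)), ω ⊆ (zdGraph 2).edgeSet → ∀ (x : Site 2) (i : Fin 2),
        pivotalWeight ε δ ω x i ≤ pivotalWeight ε' δ ω x i) →
    (∀ ε : ℝ, 0 < ε → ∀ φ : ℂ → ℝ, Continuous φ → HasCompactSupport φ →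
      ∃ C δ₀ : ℝ, 0 < δ₀ ∧ ∀ δ : ℝ, 0 < δ → δ ≤ δ₀ →
        ∫ ω, (∫ x, |φ x| ∂(z2PivotalMeasure ε δ ω)) ^ 2 ∂(bondPercolation (zdGraph 2) half) ≤ C) →
    ∀ μ : FiniteMeasure (QuadConfig (Set.univ : Set ℂ)), μ ∈ subseqQuadLimits (Set.univ : Set ℂ) →
      ∃ M : ℝ → QuadConfig (Set.univ : Set ℂ) → Measure ℂ,
        IsZ2PivotalKernelLimit μ M ∧
          IsAdmissibleKernel (μ : Measure (QuadConfig (Set.univ : Set ℂ))) M ∧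
            IsIsometryEquivariant M := by
  intro hanti hmom μ hμ
  -- N1: joint multi-cutoff limit with a measurable, locally integrable kernel
  obtain ⟨δs, M₀, hpos, h0, hlaw, hM₀, hfin, hjoint⟩ := stub_jointKernelLimit hmom μ hμ
  -- N2 + N3: everywhere-antitone measurable version, still the joint limit
  obtain ⟨M, hM, hMono, -, hfinM, hjointM⟩ :=
    antitoneVersion_of_jointLimit hanti μ M₀ δs hpos h0 hM₀ hfin hjoint
  -- N4: in particular a pivotal-kernel limit
  have hlimM : IsZ2PivotalKernelLimit μ M :=
    isZ2PivotalKernelLimit_of_jointLimit μ M δs hpos h0 hlaw hjointM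
  -- (ADM) for the version: (1),(2) from N3, (3) transported, (4) = N6, (5) = N5 (landed)
  have hadm : IsAdmissibleKernel (μ : Measure (QuadConfig (Set.univ : Set ℂ))) M :=
    ⟨hM, hMono, hfinM, stub_pivotalSupport μ M δs hpos h0 hlaw hjointM hM hfinM,
      Summit.CriticalPhenomena.CardyFormulaZ2.Theorems.CardyMeckeFlip.exists_lintegral_kernel_ball_pos
        hmom μ M hlimM hM⟩
  -- R: isometry invariance of `μ` (rotations: the sibling crux's stub; the rest is landed)
  have hiso : ∀ g : ℂ ≃ᵢ ℂ, Measure.map (QuadConfig.isometry g)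
      (μ : Measure (QuadConfig (Set.univ : Set ℂ))) = (μ : Measure (QuadConfig (Set.univ : Set ℂ))) :=
    Summit.CriticalPhenomena.CardyFormulaZ2.Cruxes.Z2LimitsSymmetric.stub_isometryOfRotation μ hμ
      (stub_rotationInvariantLimits μ hμ)
  -- N7: equivariant admissible version
  obtain ⟨M', -, hadm', hjoint', hequiv⟩ :=
    stub_equivariantVersion μ M δs hiso hpos h0 hlaw hjointM hadm
  exact ⟨M', isZ2PivotalKernelLimit_of_jointLimit μ M' δs hpos h0 hlaw hjoint', hadm', hequiv⟩

/-- stub 2a — THE EXACT LATTICE CAMPBELL–MECKE IDENTITY IN KERNEL FORM (reshape 1, node (A);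
CLOSED by p145533): for bond percolation on `δℤ²` at `p = ½`, the isometry-averaged GPS measure
`μ^ε_δ(ω) = Σ_e w_e(ω) δ_{mid e}`, every finite family of quads `Q`, every `g` and every
`φ ∈ C_c(ℂ)`,
`E[∫ φ(x) g({i | Qᵢ ∈ ω_δ}) μ^ε_δ(ω)(dx)] = E[Σ_e w_e(ω) φ(mid e) g({i | Qᵢ ∈ ω_δ} toggled at the
indices for which e is lattice-pivotal)]`. -/
theorem stub_latticeCampbellKernel :
    ∀ (ε δ : ℝ), 0 < ε → 0 < δ → ∀ (n : ℕ) (Q : Fin n → Quad (Set.univ : Set ℂ))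
      (g : Set (Fin n) → ℝ) (φ : ℂ → ℝ), Continuous φ → HasCompactSupport φ →
        ∀ E : Finset (Site 2 × Fin 2),
          (∀ p : Site 2 × Fin 2, φ (edgeMidpoint δ p.1 p.2) ≠ 0 → p ∈ E) →
            ∫ ω, ∫ z, φ z * g {i | Q i ∈ z2QuadConfig (Set.univ : Set ℂ) δ ω}
                ∂(z2PivotalMeasure ε δ ω) ∂(bondPercolation (zdGraph 2) half) =
              ∫ ω, ∑ p ∈ E, (pivotalWeight ε δ ω p.1 p.2).toReal *
                  (φ (edgeMidpoint δ p.1 p.2) *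
                    g {i | Xor (Q i ∈ z2QuadConfig (Set.univ : Set ℂ) δ ω)
                      (¬ (Q i ∈ z2QuadConfig (Set.univ : Set ℂ) δ ω ↔
                        Q i ∈ z2QuadConfig (Set.univ : Set ℂ) δ (symmDiff ω {edgeFrom p.1 p.2})))})
                ∂(bondPercolation (zdGraph 2) half) :=
  -- CLOSED (reshape 1, p145533): landed as
  -- `Theorems/CardyMeckeFlipFlipErgodicityZ2StubLatticeCampbellKernel.lean`
  Summit.CriticalPhenomena.CardyFormulaZ2.Theorems.CardyMeckeFlip.stub_latticeCampbellKernel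

/-- stub 2b-L — THE PATTERN CAMPBELL FUNCTIONALS PASS TO THE LIMIT (reshape 2; glue, CLOSED by p150116:
`tendsto_integral_mul_indicator_of_tendsto_pair` of `JointLawTruncatedLimitGlue.lean` at the
cylinder atoms `{S | {i | Qᵢ ∈ S} = T}`, which are `μ`-continuity sets by
`SchrammSmirnov2011_lemma_5_1_holds`, with `t_k = ⟨μ^ε_{δ_k}, φ^±⟩` and the uniform second moments
as the uniform-integrability input): along a mesh sequence `δ_k → 0⁺` realising `μ` and along which
`(ω_δ, μ^ε_δ(ω))` converges jointly to `(S, M ε S)` (the convergence clause of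
`IsZ2PivotalKernelLimit`, verbatim), for every `φ ∈ C_c(ℂ)` with `sup_k E[⟨μ^ε_{δ_k}, |φ|⟩²] < ∞`
and every cylinder datum `(Q, g)`,
`E[g({i | Qᵢ ∈ ω_{δ_k}}) ⟨μ^ε_{δ_k}(ω), φ⟩] → ∫ g({i | Qᵢ ∈ S}) ⟨M ε S, φ⟩ dμ(S)`. -/
theorem stub_patternCampbellLimit :
    ∀ (μ : FiniteMeasure (QuadConfig (Set.univ : Set ℂ)))
      (M : ℝ → QuadConfig (Set.univ : Set ℂ) → Measure ℂ) (δs : ℕ → ℝ),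
      (∀ k, 0 < δs k) → Tendsto δs atTop (𝓝 0) →
        Tendsto (fun k => z2QuadLaw (Set.univ : Set ℂ) (δs k)) atTop (𝓝 μ) →
          ∀ ε : ℝ, 0 < ε → Measurable (M ε) →
            (∀ (m : ℕ) (φ : Fin m → ℂ → ℝ), (∀ j, Continuous (φ j)) →
              (∀ j, HasCompactSupport (φ j)) →
                ∀ F : BoundedContinuousFunction (QuadConfig (Set.univ : Set ℂ) × (Fin m → ℝ)) ℝ,
                  Tendsto
                    (fun k => ∫ ω, F (z2QuadConfig (Set.univ : Set ℂ) (δs k) ω,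
                        fun j => ∫ x, φ j x ∂(z2PivotalMeasure ε (δs k) ω))
                      ∂(bondPercolation (zdGraph 2) half))
                    atTop
                    (𝓝 (∫ S, F (S, fun j => ∫ x, φ j x ∂(M ε S))
                      ∂(μ : Measure (QuadConfig (Set.univ : Set ℂ)))))) →
            ∀ φ : ℂ → ℝ, Continuous φ → HasCompactSupport φ →
              (∃ C : ℝ, ∀ k, ∫ ω, (∫ x, |φ x| ∂(z2PivotalMeasure ε (δs k) ω)) ^ 2
                  ∂(bondPercolation (zdGraph 2) half) ≤ C) →
                ∀ (n : ℕ) (Q : Fin n → Quad (Set.univ : Set ℂ)) (g : Set (Fin n) → ℝ),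
                  Tendsto
                    (fun k => ∫ ω, ∫ z, φ z * g {i | Q i ∈ z2QuadConfig (Set.univ : Set ℂ) (δs k) ω}
                      ∂(z2PivotalMeasure ε (δs k) ω) ∂(bondPercolation (zdGraph 2) half))
                    atTop
                    (𝓝 (∫ S, ∫ x, φ x * g {i | Q i ∈ S} ∂(M ε S)
                      ∂(μ : Measure (QuadConfig (Set.univ : Set ℂ))))) :=
  -- CLOSED (reshape 2, wave 1 of lead c2, p150116; helpers p149159
  -- `Literature/Probability/Percolation/Z2PivotalCampbellLimit.lean`): landed as
  -- `Theorems/CardyMeckeFlipFlipErgodicityZ2StubPatternCampbellLimit.lean`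
  Summit.CriticalPhenomena.CardyFormulaZ2.Theorems.CardyMeckeFlip.stub_patternCampbellLimit

/-- stub 2b-C — THE TOGGLED CAMPBELL FUNCTIONALS PASS TO THE LIMIT, IDENTIFIED BY `IsPivotalAt`
(node (C); reshape 3, signature by the wave-1 stub-worker; `𝕋`-blueprint GPS 2013 Thm 1.1 for `μ^Q`
+ GPS 2018 §6–7; UNPRINTED for bond-`ℤ²`; absorbs census risks R1 (fat-sided quads) and R2
(measurability of the toggled integrand)).  Along a mesh sequence realising `μ` with the joint
convergence of `IsZ2PivotalKernelLimit` at every cutoff, for an admissible family and given uniform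
second moments along the sequence: for every `ε > 0`, cylinder datum `(Q, g)`, `φ ∈ C_c(ℂ)` and
finite edge sets `E k` outside which `φ(mid e) = 0` at mesh `δ_k`,
`E[Σ_{e ∈ E k} w_e φ(mid e) g(pattern(ω_{δ_k}) toggled where e is lattice-pivotal)]
  → ∫∫ φ(x) g({i | Qᵢ ∈ S} toggled where x is pivotal) (M ε S)(dx) dμ(S)`. -/
theorem stub_nodeC :
    (∀ (μ : FiniteMeasure (QuadConfig (Set.univ : Set ℂ)))
      (M : ℝ → QuadConfig (Set.univ : Set ℂ) → Measure ℂ) (δs : ℕ → ℝ),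
      (∀ k, 0 < δs k) → Tendsto δs atTop (𝓝 0) →
        Tendsto (fun k => z2QuadLaw (Set.univ : Set ℂ) (δs k)) atTop (𝓝 μ) →
          (∀ ε : ℝ, 0 < ε → ∀ m (φ : Fin m → ℂ → ℝ), (∀ j, Continuous (φ j)) →
            (∀ j, HasCompactSupport (φ j)) →
              ∀ F : BoundedContinuousFunction (QuadConfig (Set.univ : Set ℂ) × (Fin m → ℝ)) ℝ,
                Tendsto
                  (fun k => ∫ ω, F (z2QuadConfig (Set.univ : Set ℂ) (δs k) ω,
                      fun j => ∫ x, φ j x ∂(z2PivotalMeasure ε (δs k) ω))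
                    ∂(bondPercolation (zdGraph 2) half))
                  atTop
                  (𝓝 (∫ S, F (S, fun j => ∫ x, φ j x ∂(M ε S))
                    ∂(μ : Measure (QuadConfig (Set.univ : Set ℂ)))))) →
          IsAdmissibleKernel (μ : Measure (QuadConfig (Set.univ : Set ℂ))) M →
          (∀ ε : ℝ, 0 < ε → ∀ φ : ℂ → ℝ, Continuous φ → HasCompactSupport φ →
            ∃ C, ∀ k, ∫ ω, (∫ x, |φ x| ∂(z2PivotalMeasure ε (δs k) ω)) ^ 2
              ∂(bondPercolation (zdGraph 2) half) ≤ C) →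
          ∀ ε : ℝ, 0 < ε → ∀ n (Q : Fin n → Quad (Set.univ : Set ℂ)) (g : Set (Fin n) → ℝ)
            (φ : ℂ → ℝ), Continuous φ → HasCompactSupport φ →
              ∀ E : ℕ → Finset (Site 2 × Fin 2),
                (∀ k, ∀ p ∉ E k, φ (edgeMidpoint (δs k) p.1 p.2) = 0) →
                Tendsto
                  (fun k => ∫ ω, ∑ p ∈ E k, (pivotalWeight ε (δs k) ω p.1 p.2).toReal *
                    (φ (edgeMidpoint (δs k) p.1 p.2) *
                      g {i | Xor (Q i ∈ z2QuadConfig (Set.univ : Set ℂ) (δs k) ω)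
                        (¬ (Q i ∈ z2QuadConfig (Set.univ : Set ℂ) (δs k) ω ↔
                          Q i ∈ z2QuadConfig (Set.univ : Set ℂ) (δs k)
                            (symmDiff ω {edgeFrom p.1 p.2})))})
                    ∂(bondPercolation (zdGraph 2) half))
                  atTop
                  (𝓝 (∫ S, ∫ x, φ x * g {i | Xor (Q i ∈ S) (S.IsPivotalAt x (Q i))} ∂(M ε S)
                    ∂(μ : Measure (QuadConfig (Set.univ : Set ℂ)))))) := by
  sorry

/-- stub 2b — THE FLIP IDENTITY PASSES TO THE LIMIT, from the glue (GPS 2018 §11.1 in Campbell–Mecke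
form).  Hypotheses: the lattice Campbell–Mecke identity (stub 2a, closed), the limit passage of the
pattern Campbell functionals (stub 2b-L, closed) and the uniform second moments (stub 1b).  CLOSED
modulo `stub_nodeC` by the landed glue `flipPassesToLimit_of_nodeC` (wave 1 of lead c3, p163085). -/
theorem stub_flipPassesToLimit_of_glue :
    (∀ (ε δ : ℝ), 0 < ε → 0 < δ → ∀ (n : ℕ) (Q : Fin n → Quad (Set.univ : Set ℂ))
      (g : Set (Fin n) → ℝ) (φ : ℂ → ℝ), Continuous φ → HasCompactSupport φ →
        ∀ E : Finset (Site 2 × Fin 2),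
          (∀ p : Site 2 × Fin 2, φ (edgeMidpoint δ p.1 p.2) ≠ 0 → p ∈ E) →
            ∫ ω, ∫ z, φ z * g {i | Q i ∈ z2QuadConfig (Set.univ : Set ℂ) δ ω}
                ∂(z2PivotalMeasure ε δ ω) ∂(bondPercolation (zdGraph 2) half) =
              ∫ ω, ∑ p ∈ E, (pivotalWeight ε δ ω p.1 p.2).toReal *
                  (φ (edgeMidpoint δ p.1 p.2) *
                    g {i | Xor (Q i ∈ z2QuadConfig (Set.univ : Set ℂ) δ ω)
                      (¬ (Q i ∈ z2QuadConfig (Set.univ : Set ℂ) δ ω ↔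
                        Q i ∈ z2QuadConfig (Set.univ : Set ℂ) δ (symmDiff ω {edgeFrom p.1 p.2})))})
                ∂(bondPercolation (zdGraph 2) half)) →
    (∀ (μ : FiniteMeasure (QuadConfig (Set.univ : Set ℂ)))
      (M : ℝ → QuadConfig (Set.univ : Set ℂ) → Measure ℂ) (δs : ℕ → ℝ),
      (∀ k, 0 < δs k) → Tendsto δs atTop (𝓝 0) →
        Tendsto (fun k => z2QuadLaw (Set.univ : Set ℂ) (δs k)) atTop (𝓝 μ) →
          ∀ ε : ℝ, 0 < ε → Measurable (M ε) →
            (∀ (m : ℕ) (φ : Fin m → ℂ → ℝ), (∀ j, Continuous (φ j)) →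
              (∀ j, HasCompactSupport (φ j)) →
                ∀ F : BoundedContinuousFunction (QuadConfig (Set.univ : Set ℂ) × (Fin m → ℝ)) ℝ,
                  Tendsto
                    (fun k => ∫ ω, F (z2QuadConfig (Set.univ : Set ℂ) (δs k) ω,
                        fun j => ∫ x, φ j x ∂(z2PivotalMeasure ε (δs k) ω))
                      ∂(bondPercolation (zdGraph 2) half))
                    atTop
                    (𝓝 (∫ S, F (S, fun j => ∫ x, φ j x ∂(M ε S))
                      ∂(μ : Measure (QuadConfig (Set.univ : Set ℂ)))))) →
            ∀ φ : ℂ → ℝ, Continuous φ → HasCompactSupport φ →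
              (∃ C : ℝ, ∀ k, ∫ ω, (∫ x, |φ x| ∂(z2PivotalMeasure ε (δs k) ω)) ^ 2
                  ∂(bondPercolation (zdGraph 2) half) ≤ C) →
                ∀ (n : ℕ) (Q : Fin n → Quad (Set.univ : Set ℂ)) (g : Set (Fin n) → ℝ),
                  Tendsto
                    (fun k => ∫ ω, ∫ z, φ z * g {i | Q i ∈ z2QuadConfig (Set.univ : Set ℂ) (δs k) ω}
                      ∂(z2PivotalMeasure ε (δs k) ω) ∂(bondPercolation (zdGraph 2) half))
                    atTop
                    (𝓝 (∫ S, ∫ x, φ x * g {i | Q i ∈ S} ∂(M ε S)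
                      ∂(μ : Measure (QuadConfig (Set.univ : Set ℂ)))))) →
    (∀ ε : ℝ, 0 < ε → ∀ φ : ℂ → ℝ, Continuous φ → HasCompactSupport φ →
      ∃ C δ₀ : ℝ, 0 < δ₀ ∧ ∀ δ : ℝ, 0 < δ → δ ≤ δ₀ →
        ∫ ω, (∫ x, |φ x| ∂(z2PivotalMeasure ε δ ω)) ^ 2 ∂(bondPercolation (zdGraph 2) half) ≤ C) →
    ∀ (μ : FiniteMeasure (QuadConfig (Set.univ : Set ℂ)))
      (M : ℝ → QuadConfig (Set.univ : Set ℂ) → Measure ℂ),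
      IsZ2PivotalKernelLimit μ M →
        IsAdmissibleKernel (μ : Measure (QuadConfig (Set.univ : Set ℂ))) M →
          ∀ ε : ℝ, 0 < ε →
            IsFlipFairKernel (μ : Measure (QuadConfig (Set.univ : Set ℂ))) (M ε) :=
  Summit.CriticalPhenomena.CardyFormulaZ2.Theorems.CardyMeckeFlip.flipPassesToLimit_of_nodeC stub_nodeC

/-- stub 3 — PIVOTAL-KERNEL ERGODICITY, density form (the open core of K3; `𝕋`-analogue: GHSS
arXiv:1905.06940 Thm 1.4(i) + Rem 1.5; GPS 2018 §12.1 Remark): for the canonical admissible,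
isometry-equivariant, flip-fair kernel family of `μ ∈ Λ`, every bounded density `f ≤ 2` whose
tilt `f·μ` is a flip-fair probability law is trivial: `f·μ = μ`. -/
theorem stub_pivotalKernelErgodic :
    ∀ (μ : FiniteMeasure (QuadConfig (Set.univ : Set ℂ)))
      (M : ℝ → QuadConfig (Set.univ : Set ℂ) → Measure ℂ),
      IsZ2PivotalKernelLimit μ M →
        IsAdmissibleKernel (μ : Measure (QuadConfig (Set.univ : Set ℂ))) M →
          IsIsometryEquivariant M →
            (∀ ε : ℝ, 0 < ε →
              IsFlipFairKernel (μ : Measure (QuadConfig (Set.univ : Set ℂ))) (M ε)) →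
              ∀ f : QuadConfig (Set.univ : Set ℂ) → ENNReal, Measurable f → (∀ S, f S ≤ 2) →
                IsProbabilityMeasure
                    ((μ : Measure (QuadConfig (Set.univ : Set ℂ))).withDensity f) →
                  (∀ ε : ℝ, 0 < ε →
                    IsFlipFairKernel
                      ((μ : Measure (QuadConfig (Set.univ : Set ℂ))).withDensity f) (M ε)) →
                    (μ : Measure (QuadConfig (Set.univ : Set ℂ))).withDensity f =
                      (μ : Measure (QuadConfig (Set.univ : Set ℂ))) := by
  sorry

/-- stub 4 — DENSITY TRIVIALITY ⇒ MIDPOINT-EXTREMALITY (measure theory; CLOSED by p143383): if every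
bounded density `f ≤ 2` with `f·P` a flip-fair probability law is trivial, then `P` is
flip-extremal (`P₁ + P₂ = P + P` forces `P₁ ≤ 2P`, hence `P₁ = P.withDensity f` with
`f = min (∂P₁/∂P) 2`). -/
theorem stub_flipExtremal_of_trivialDensity :
    ∀ (P : Measure (QuadConfig (Set.univ : Set ℂ)))
      (M : ℝ → QuadConfig (Set.univ : Set ℂ) → Measure ℂ),
      (∀ f : QuadConfig (Set.univ : Set ℂ) → ENNReal, Measurable f → (∀ S, f S ≤ 2) →
        IsProbabilityMeasure (P.withDensity f) →
          (∀ ε : ℝ, 0 < ε → IsFlipFairKernel (P.withDensity f) (M ε)) →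
            P.withDensity f = P) →
        IsFlipExtremal P M :=
  -- CLOSED (wave 1, p143383): landed as
  -- `Theorems/CardyMeckeFlipFlipErgodicityZ2StubFlipExtremalOfTrivialDensity.lean`
  Summit.CriticalPhenomena.CardyFormulaZ2.Theorems.CardyMeckeFlip.stub_flipExtremal_of_trivialDensity

/-- ASSEMBLY (kernel-checked; its own term contains no `sorry` — `sorryAx` enters only through the
named stubs): the stubs imply the crux, concluded BY NAME.  Shape required by
`ledger skeleton check` (no `Prop` hypotheses other than registered obligations): the stubs are
invoked by name inside the proof. -/
theorem FlipErgodicityZ2_of :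
    Summit.CriticalPhenomena.CardyFormulaZ2.Theses.CardyMeckeFlip.FlipErgodicityZ2 := by
  intro Piv hPiv μ hμ
  -- the characterised parameter IS the named pivotal predicate
  obtain rfl : Piv = fun S x Q => QuadConfig.IsPivotalAt S x Q :=
    QuadConfig.eq_isPivotalAt_of_forall_iff hPiv
  -- the lattice nodes (stubs 1a, 1b) and the glue node (stub 2b-L)
  have hanti := stub_latticePivotalAntitone
  have hmom := stub_latticeSecondMoment
  have hpat := stub_patternCampbellLimit
  -- stub 1: the canonical kernel, admissible and equivariant
  obtain ⟨M, hlim, hadm, hequiv⟩ := stub_kernelExistsZ2_of_lattice hanti hmom μ hμ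
  -- stubs 2a + 2b-L + 1b + 2b: the flip identity (F) at every cutoff
  have hff : ∀ ε : ℝ, 0 < ε →
      IsFlipFairKernel (μ : Measure (QuadConfig (Set.univ : Set ℂ))) (M ε) :=
    stub_flipPassesToLimit_of_glue stub_latticeCampbellKernel hpat hmom μ M hlim hadm
  -- stub 3: bounded flip-fair densities are trivial
  have hdens := stub_pivotalKernelErgodic μ M hlim hadm hequiv hff
  -- stub 4: hence midpoint-extremality (EXT)
  have hext : IsFlipExtremal (μ : Measure (QuadConfig (Set.univ : Set ℂ))) M :=
    stub_flipExtremal_of_trivialDensity _ M hdens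
  -- unfold the named clauses to the crux's inlined text (all `Iff.rfl`)
  refine ⟨M, (isAdmissibleKernel_and_isIsometryEquivariant_iff _ M).1 ⟨hadm, hequiv⟩, ?_, ?_⟩
  · intro ε hε
    exact (isFlipFairKernel_iff _ _).1 (hff ε hε)
  · exact (isFlipExtremal_iff _ M).1 hext

end Summit.CriticalPhenomena.CardyFormulaZ2.Cruxes.FlipErgodicityZ2.Birth

end
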